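import Summits.QuantumAdvantage.QuantumAdvantage.Theorems.CharDialSegmentMovesB
import Summits.QuantumAdvantage.QuantumAdvantage.Theorems.CharDialJLinPeel
import Summits.QuantumAdvantage.AdviceFreeQNC0.TransferWalk
import Literature.Computability.MetaComplexity.TwoModuliExpSums
import HarnessLib

/-!
# CharDial tower — the TOKEN DIAL, part A1: the adjacent transposition, addresses, the token-transfer pairing (§1–§3)

Cell `decomp-qadv`, lens 6, generation 19; supports `JLinLowResidual5` (stmt-QuantumAdvantage-27206) and `JLinResidualHigh5` (27207).
Split of the lens file `CharDialTokenDialA.lean` (sha f4f92cd1…) into A1 (§1–§3) → A2 (§4) → A (§5, the engine) for the gate line limit;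
content verbatim.  See part A for the full module description.  0 sorry.
-/

set_option autoImplicit false

namespace Summit.QuantumAdvantage.AdviceFreeQNC0.JLinPeel.TokenDial

open Finset SegMove

variable {n : ℕ}

/-! ### §1 the adjacent transposition and the walk -/

/-- an empty window carries no ones. -/
theorem wseg_eq_zero_of_le (u : Fin n → Bool) {i k : ℕ} (h : k ≤ i) : wseg u i k = 0 := by
  unfold wseg
  rw [card_eq_zero, filter_eq_empty_iff]
  rintro x - ⟨⟨h1, h2⟩, -⟩
  omega

/-- the one-position window `[s, s+1)` carries the bit `u_s`. -/
theorem wseg_single (u : Fin n → Bool) (s : Fin n) : wseg u s.val (s.val + 1) = if u s = true then 1 else 0 := by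
  unfold wseg
  split_ifs with hs
  · rw [card_eq_one]
    refine ⟨s, ?_⟩
    ext x
    simp only [mem_filter, mem_univ, true_and, mem_singleton]
    constructor
    · rintro ⟨⟨h1, h2⟩, -⟩; exact Fin.ext (by omega)
    · rintro rfl; exact ⟨⟨le_rfl, Nat.lt_succ_self _⟩, hs⟩
  · rw [card_eq_zero, filter_eq_empty_iff]
    rintro x - ⟨⟨h1, h2⟩, hx⟩
    have : x = s := Fin.ext (by omega)
    rw [this] at hx
    exact hs hx

/-- on the swap set the window `[s, s+2)` carries exactly one `1`. -/
theorem wseg_pair (u : Fin n → Bool) (s t : Fin n) (hst : t.val = s.val + 1) (hne : u s ≠ u t) :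
    wseg u s.val (s.val + 2) = 1 := by
  unfold wseg
  rw [card_eq_one]
  have hwin : ∀ x : Fin n, (s.val ≤ x.val ∧ x.val < s.val + 2) ↔ (x = s ∨ x = t) := by
    intro x
    constructor
    · intro h
      rcases Nat.lt_or_ge x.val (s.val + 1) with h1 | h1
      · left; exact Fin.ext (by omega)
      · right; exact Fin.ext (by omega)
    · rintro (rfl | rfl) <;> omega
  rcases Bool.eq_false_or_eq_true (u s) with hs | hs
  · have ht : u t = false := by
      rcases Bool.eq_false_or_eq_true (u t) with h | h
      · exact absurd (hs.trans h.symm) hne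
      · exact h
    refine ⟨s, ?_⟩
    ext x
    simp only [mem_filter, mem_univ, true_and, mem_singleton, hwin]
    constructor
    · rintro ⟨hx | hx, hu⟩
      · exact hx
      · rw [hx, ht] at hu; exact absurd hu Bool.false_ne_true
    · rintro rfl; exact ⟨Or.inl rfl, hs⟩
  · have ht : u t = true := by
      rcases Bool.eq_false_or_eq_true (u t) with h | h
      · exact h
      · exact absurd (hs.trans h.symm) hne
    refine ⟨t, ?_⟩
    ext x
    simp only [mem_filter, mem_univ, true_and, mem_singleton, hwin]
    constructor
    · rintro ⟨hx | hx, hu⟩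
      · rw [hx, hs] at hu; exact absurd hu Bool.false_ne_true
      · exact hx
    · rintro rfl; exact ⟨Or.inr rfl, ht⟩

/-- **swap law (other cuts).** the transposition does not change the walk exponent of any cut other than cut `s+1`. -/
theorem walkExp_swap_of_ne (u : Fin n → Bool) (s t : Fin n) (hst : t.val = s.val + 1) (hne : u s ≠ u t)
    {g : ℕ} (hg : g ≠ s.val + 1) : walkExp (segCompl u s.val (s.val + 2)) g = walkExp u g := by
  have ht2 : s.val + 2 ≤ n := by have := t.isLt; omega
  have hb := walkExp_segCompl u (i := s.val) ht2 g
  rw [wseg_pair u s t hst hne] at hb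
  rcases Nat.lt_or_ge g (s.val + 1) with h | h
  · rw [min_eq_left (by omega : g ≤ s.val + 2), wseg_eq_zero_of_le u (by omega : g ≤ s.val)] at hb
    omega
  · rw [min_eq_right (by omega : s.val + 2 ≤ g), wseg_pair u s t hst hne] at hb
    omega

/-- **swap law (the cut in between).** at cut `s+1` the walk exponent moves by `−1` (`u_s = 1`) or `+1` (`u_s = 0`). -/
theorem walkExp_swap_at (u : Fin n → Bool) (s t : Fin n) (hst : t.val = s.val + 1) (hne : u s ≠ u t) :
    walkExp (segCompl u s.val (s.val + 2)) (s.val + 1) + (if u s = true then 2 else 0) = walkExp u (s.val + 1) + 1 := by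
  have ht2 : s.val + 2 ≤ n := by have := t.isLt; omega
  have hb := walkExp_segCompl u (i := s.val) ht2 (s.val + 1)
  rw [wseg_pair u s t hst hne, min_eq_left (by omega : s.val + 1 ≤ s.val + 2), wseg_single u s] at hb
  split_ifs at hb ⊢ with h <;> omega

/-- the swap keeps the two bits different. -/
theorem swap_ne (u : Fin n → Bool) (s t : Fin n) (hst : t.val = s.val + 1) (hne : u s ≠ u t) :
    segCompl u s.val (s.val + 2) s ≠ segCompl u s.val (s.val + 2) t := by
  simp only [segCompl_apply, show s.val ≤ s.val ∧ s.val < s.val + 2 from ⟨le_rfl, by omega⟩,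
    show s.val ≤ t.val ∧ t.val < s.val + 2 from ⟨by omega, by omega⟩]
  intro h
  exact hne (Bool.not_inj h)

/-- the swapped bit at `s`. -/
theorem swap_apply_s (u : Fin n → Bool) (s : Fin n) : segCompl u s.val (s.val + 2) s = !u s := by
  simp [segCompl_apply]

/-! ### §2 addresses and the win bit under the transposition -/

/-- addresses of cuts other than `s+1` are unchanged. -/
theorem addr_swap_of_ne (c : ℕ) (u : Fin n → Bool) (s t : Fin n) (hst : t.val = s.val + 1) (hne : u s ≠ u t)
    {g : ℕ} (hg : g ≠ s.val + 1) : addr c (segCompl u s.val (s.val + 2)) g = addr c u g := by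
  rw [addr_eq, addr_eq, walkExp_swap_of_ne u s t hst hne hg]

/-- **address shift.** the address of cut `s+1` moves by `+2` (`u_s = 1`) or `+1` (`u_s = 0`) mod 3. -/
theorem addr_swap_at (c : ℕ) (u : Fin n → Bool) (s t : Fin n) (hst : t.val = s.val + 1) (hne : u s ≠ u t) :
    addr c (segCompl u s.val (s.val + 2)) (s.val + 1) = (addr c u (s.val + 1) + if u s = true then 2 else 1) % 3 := by
  have h := walkExp_swap_at u s t hst hne
  rw [addr_eq, addr_eq]
  split_ifs at h ⊢ with hs <;> omega

/-- splitting one cut off the fired-live count. -/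
theorem flc_split (c : ℕ) (y : Fin (n + 1) → (Fin n → Bool) → Bool) (v : Fin n → Bool) (g₀ : Fin (n + 1)) :
    flc c y v = (if y g₀ v = true ∧ (c + g₀.val + walkExp v g₀.val) % 3 ≠ 0 then 1 else 0) +
      ((univ.erase g₀).filter fun g : Fin (n + 1) => y g v = true ∧ (c + g.val + walkExp v g.val) % 3 ≠ 0).card := by
  unfold flc
  rw [card_filter, card_filter, ← add_sum_erase univ _ (mem_univ g₀)]

/-- the cut numbered `t` (between positions `s` and `t = s+1`), as an element of `Fin (n+1)`. -/
def cut (t : Fin n) : Fin (n + 1) := ⟨t.val, Nat.lt_succ_of_lt t.isLt⟩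

/-- its number. -/
@[simp] theorem cut_val (t : Fin n) : (cut t).val = t.val := rfl

/-- **LAW (win flip).** if no cut's decision feels the transposition and cut `t` accepts `u`, then the win bit flips iff
cut `t` is at address `0` before or after the swap (exactly one of the two, by the address shift). -/
theorem ringWinU_swap_ne (c : ℕ) (y : Fin (n + 1) → (Fin n → Bool) → Bool) (u : Fin n → Bool) (s t : Fin n)
    (hst : t.val = s.val + 1) (hne : u s ≠ u t) (hdead : ∀ g, y g (segCompl u s.val (s.val + 2)) = y g u)
    (hfire : y (cut t) u = true)
    (h0 : addr c u t.val = 0 ∨ addr c (segCompl u s.val (s.val + 2)) t.val = 0) :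
    ringWinU c y (segCompl u s.val (s.val + 2)) ≠ ringWinU c y u := by
  have hrest : ((univ.erase (cut t)).filter fun g : Fin (n + 1) =>
        y g (segCompl u s.val (s.val + 2)) = true ∧ (c + g.val + walkExp (segCompl u s.val (s.val + 2)) g.val) % 3 ≠ 0)
      = (univ.erase (cut t)).filter fun g : Fin (n + 1) => y g u = true ∧ (c + g.val + walkExp u g.val) % 3 ≠ 0 := by
    refine filter_congr fun g hg => ?_
    have hg' : g.val ≠ s.val + 1 := fun h => (ne_of_mem_erase hg) (Fin.ext (by rw [cut_val]; omega))
    rw [hdead g, walkExp_swap_of_ne u s t hst hne hg']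
  have e1 := flc_split c y (segCompl u s.val (s.val + 2)) (cut t)
  have e2 := flc_split c y u (cut t)
  rw [hrest, hdead (cut t), hfire] at e1
  rw [hfire] at e2
  simp only [true_and, cut_val] at e1 e2
  have hshift := addr_swap_at c u s t hst hne
  rw [addr_eq, addr_eq, ← hst] at hshift
  rw [addr_eq, addr_eq] at h0
  rw [ne_eq, ringWinU_eq_decide, ringWinU_eq_decide]
  intro heq
  have hiff : (flc c y (segCompl u s.val (s.val + 2)) % 2 = 1) ↔ (flc c y u % 2 = 1) := by
    simpa using congrArg (fun b => b = true) heq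
  rcases h0 with h | h <;> split_ifs at e1 e2 hshift <;> omega

/-! ### §3 the token-transfer set and the pairing inequality -/

/-- **the token-transfer set** of the pair `(s, t)`: swap-set inputs accepted by cut `t` at which cut `t` is at address `0`
before or after the transposition. -/
def tokE (c : ℕ) (y : Fin (n + 1) → (Fin n → Bool) → Bool) (s t : Fin n) : Finset (Fin n → Bool) :=
  univ.filter fun u => u s ≠ u t ∧ y (cut t) u = true ∧
    (addr c u t.val = 0 ∨ addr c (segCompl u s.val (s.val + 2)) t.val = 0)

/-- membership in `tokE`. -/
theorem mem_tokE (c : ℕ) (y : Fin (n + 1) → (Fin n → Bool) → Bool) (s t : Fin n) (u : Fin n → Bool) :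
    u ∈ tokE c y s t ↔ u s ≠ u t ∧ y (cut t) u = true ∧
      (addr c u t.val = 0 ∨ addr c (segCompl u s.val (s.val + 2)) t.val = 0) := by
  unfold tokE; rw [mem_filter]; simp only [mem_univ, true_and]

/-- **pairing inequality.** if the pair `(s, t)` is dead for the strategy (no cut's output feels the transposition on the
swap set) then `2·#WIN + |tokE| ≤ 2·2ⁿ`. -/
theorem tok_pairing (c : ℕ) (y : Fin (n + 1) → (Fin n → Bool) → Bool) (s t : Fin n) (hst : t.val = s.val + 1)
    (hdead : ∀ g (u : Fin n → Bool), u s ≠ u t → y g (segCompl u s.val (s.val + 2)) = y g u) :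
    2 * (univ.filter fun u : Fin n → Bool => ringWinU c y u = true).card + (tokE c y s t).card ≤ 2 * 2 ^ n := by
  refine pairing_law c y (tokE c y s t) (fun u => segCompl u s.val (s.val + 2)) ?_ ?_ ?_
  · intro u hu
    obtain ⟨hne, hfire, h0⟩ := (mem_tokE c y s t u).1 hu
    rw [mem_tokE]
    refine ⟨swap_ne u s t hst hne, by rw [hdead _ u hne]; exact hfire, ?_⟩
    rw [segCompl_segCompl]
    exact h0.symm
  · intro u _; exact segCompl_segCompl u _ _
  · intro u hu
    obtain ⟨hne, hfire, h0⟩ := (mem_tokE c y s t u).1 hu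
    exact ringWinU_swap_ne c y u s t hst hne (fun g => hdead g u hne) hfire h0


end Summit.QuantumAdvantage.AdviceFreeQNC0.JLinPeel.TokenDial
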